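import HarnessLib
import Literature.MathematicalPhysics.QuantumFieldTheory.Balaban1983to89.Beta.SliceLegs
import Literature.MathematicalPhysics.QuantumFieldTheory.Balaban1983to89.B5Leaf237C0Torus

/-!
# Beta / SliceLegsLeafK0 — the `K0` conjunct of the located leaf `B5Ineq137.Leaf235to237` DISCHARGED for the
# VALUE and GRADIENT slice legs of `Beta/SliceLegs`; all three tail theorems reduced to the `K1/K2/K3` clauses

HONEST FRAMING (verbatim, page 1 of everything this cell writes): discharging `BetaPertH` makes Bałaban's UV
stability UNCONDITIONAL — a real constructive-QFT result; it is NOT the continuum limit and NOT the Clay problem.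
ABSOLUTE RULE: no internally-minted statement enters as a cited fact; every hypothesis below is either kernel-proved in
the tree or an explicit hypothesis of the theorem that uses it.  THIS MODULE asserts nothing printed: it is a
Mathlib-elementary certificate about Bałaban's concrete SCALAR (`U = 1`) torus tower `B1RG242Torus.tower P a m²`
(pv07), combining two tree modules.  Zero cited facts.  v1.0.1 = v1 (p181885) with a docstring-only DOCFIX
(XREAD pv27-g4, GAPS G-pv27-3): the Context quotation of [B4] Lemma 2.4 made verbatim ((2.35) value + derivative,
(2.37) covariance; «(□; » restored) and one tag locator corrected; no declaration, statement or proof changed.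

WHAT IS PROVED.  `Beta/SliceLegs` (p181750) bounds the three legs of the one-loop bubble — MIXED
`(∂^ε_μ G^ε_k ∂^{εᵀ}_ν)(x,x′)`, VALUE `ε^{−2}G^ε_k(x,x′)`, GRADIENT `ε^{−1}(∂^ε_μ G^ε_k)(x,x′)` — in the (W3a)₀ shapes
`R′/|x−x′|^s · e^{−(δ/n)|x−x′|}` (`n = L^k`) under ONE located hypothesis each, the leaf
`B5Ineq137.Leaf235to237 (dataM | dataV | dataG) L c₀ δ₀′` = the kernel bounds (2.35)–(2.37) of [B4] Lemma 2.4 for the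
`j = 0` kernel `K0` and for the three kernel families `K1, K2, K3` at the levels `1 ≤ j < k`.  pv07-g7's
`B5Leaf237C0Torus` (p181774) PROVED the `K0` conjunct for the mixed leg (`leafK0_torus`: `K0 = ∂¹_μ C^{(0)} ∂¹ᵀ_ν`) from
its kernel theorem `G0unit_decay`: `|C^{(0)}(x,x′)| ≤ (2/γ₀)·e^{−δ₁|x−x′|}` on the unit lattice `ε^{−1}T_ε`, `γ₀ = min{8,a}/L²`,
`δ₁ = dK0 d L a m²`, uniformly in the volume and the cutoff, and split the leaf as `LeafK0 ∧ LeafK123`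
(`leaf235to237_iff`).  Here:
* §1 two inequalities between pv07's constants: `2/γ₀ ≤ cK0` and `(2/γ₀)(e^{δ₁} + 1) ≤ cK0` (`cK0 = 4(2/γ₀)e^{2δ₁}`).
* §2 `LeafK0` for the VALUE leg data `dataV` (`K0v = C^{(0)} = G0unit`, `SliceLegs.K0v_eq`): immediate from
  `G0unit_decay` (`leafK0_dataV`).
* §3 `LeafK0` for the GRADIENT leg data `dataG` (`K0g = ∂¹_μ C^{(0)}`, `SliceLegs.K0g_eq`): the forward difference of two
  values of `C^{(0)}`, the shifted one controlled through the one-step triangle inequality `|x+e_μ−x′| ≥ |x−x′| − 1`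
  (`B5Leaf237C0Torus.T_shift_le_one`), giving the factor `e^{δ₁} + 1 ≤ 4e^{2δ₁}` (`leafK0_dataG`).  No gain from the
  derivative is claimed or needed (the blocking factor `L` is FIXED on the β road; only `k`- and volume-uniformity count).
* §4 the leaf of each of the three legs follows from pv07's `LeafK123` alone, for any `c₀ ≥ cK0`, `δ₀′ ≤ dK0`
  (`leaf_dataM_of_K123` = pv07's `leaf235to237_of_K123` read on `dataM ≡ scaleData P S (aux P S ⊥ 0)`,
  `leaf_dataV_of_K123`, `leaf_dataG_of_K123`).
* §5 COROLLARIES: the three tail theorems of `SliceLegs` §4 with the leaf hypothesis replaced by `LeafK123`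
  (`mixedLeg_tail_of_K123`, `valueLeg_tail_of_K123`, `gradLeg_tail_of_K123`).
WHAT REMAINS (located, NOT asserted): `LeafK123 S (dataM | dataV | dataG P S a m²) c₀ δ₀′` — per leg TWO block-leg
kernel families (`K1`, `K3`: value `G_j^{resc}Q_j^*` resp. `L^j`·gradient `L^j∇(G_j^{resc}Q_j^*)`, by the symmetry of
`G_j^{resc}` also on the right) and ONE fluctuation-covariance family (`K2 = (L^jε)^{−2}C^{(j)}`), with `(c₀, δ₀′)` allowed
to depend on `(d, L, a)` but not on `j`, `k` or the volume.  Tree theorems proving such bounds on OTHER carriers exist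
(pv23-g4 `Beta/TransportLeg.block_legs`, an5 `Beta/FluctuationCovariance.Cfl_entry_decay`, on `Tor (fine (n+1) M)`);
the carrier dictionary `Site P j ≃ Tor (fine L Nv_{j+1})` and the `j`-uniformity of their constants over
`a_j ∈ (a(1−L^{−2}), a]` are NOT provided here (cell records GAPS C-an1-21).

Context (not used in proofs).  [B4] p. 582, Lemma 2.4: «There exist positive constants c₀, δ₀, … such that
|(G_j(□)Q*_j)(x, y)|, |(∂^{L^{−j}}_μG_j(□)Q*_j)(x, y)| ≤ c₀e^{−δ₀|x−y|}, (2.35) … |C^{(j)}(□; y, y′)| ≤ c₀e^{−δ₀|y−y′|}, (2.37)»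
(the derivative estimate is the second member of (2.35); (2.36) is the Hölder estimate, not used); [B5] p. 40 (1.137):
«and applying the estimates (2.35)–(2.37) of Lemma 2.4 in [2] we obtain …».  B4 = [cite: Balaban1983RegularityDecay];
B5 = [cite: Balaban1984PropagatorsI]; B1 = [cite: Balaban1982Higgs1].
-/

namespace Literature.MathematicalPhysics.QuantumFieldTheory.Balaban1983to89

open Matrix

noncomputable section

namespace Beta.SliceLegsLeafK0

open B1RG242Torus
open B5Display136Torus (scaleData G0unit)
open B5Ineq137Torus (T distX T_nonneg T_triangle T_symm)
open B5Leaf237C0Torus (LeafK0 LeafK123 leaf235to237_iff gamma0 dK0 cK0 G0unit_decay gamma0_pos dK0_pos cK0_nonneg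
  decay_mono T_shift_le_one leaf235to237_of_K123)
open Beta.SliceLegs (dataM dataV dataG aux0 K0v K1v K3v K0g legConst K0v_eq K0g_eq T_pos_of_ne legConst_nonneg
  tail_shapes mixedLeg_le valueLeg_le gradLeg_le)

variable {P : Params} {S : B5.Setting}

/-! ## §1. Two inequalities between pv07's constants -/

/-- `2/γ₀ ≤ cK0 = 4·(2/γ₀)·e^{2δ₁}`. [folklore] -/
theorem two_div_gamma0_le_cK0 {a msq : ℝ} (ha : 0 < a) (hm : 0 ≤ msq) :
    2 / gamma0 P.L a ≤ cK0 P.d P.L a msq := by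
  have hg : 0 < 2 / gamma0 P.L a := div_pos two_pos (gamma0_pos (P := P) ha)
  have he : 1 ≤ Real.exp (2 * dK0 P.d P.L a msq) :=
    Real.one_le_exp (by have := dK0_pos (P := P) ha hm; positivity)
  unfold cK0
  nlinarith

/-- `(2/γ₀)·(e^{δ₁} + 1) ≤ cK0`. [folklore] -/
theorem shifted_const_le_cK0 {a msq : ℝ} (ha : 0 < a) (hm : 0 ≤ msq) :
    2 / gamma0 P.L a * (Real.exp (dK0 P.d P.L a msq) + 1) ≤ cK0 P.d P.L a msq := by
  have hg : 0 < 2 / gamma0 P.L a := div_pos two_pos (gamma0_pos (P := P) ha)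
  have hδ : 0 ≤ dK0 P.d P.L a msq := (dK0_pos (P := P) ha hm).le
  have he1 : 1 ≤ Real.exp (dK0 P.d P.L a msq) := Real.one_le_exp hδ
  have he2 : Real.exp (2 * dK0 P.d P.L a msq) = Real.exp (dK0 P.d P.L a msq) ^ 2 := by
    rw [← Real.exp_nat_mul]; norm_num
  have h4 : Real.exp (dK0 P.d P.L a msq) + 1 ≤ 4 * Real.exp (2 * dK0 P.d P.L a msq) := by
    rw [he2]; nlinarith
  unfold cK0
  calc 2 / gamma0 P.L a * (Real.exp (dK0 P.d P.L a msq) + 1)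
      ≤ 2 / gamma0 P.L a * (4 * Real.exp (2 * dK0 P.d P.L a msq)) := mul_le_mul_of_nonneg_left h4 hg.le
    _ = 4 * (2 / gamma0 P.L a) * Real.exp (2 * dK0 P.d P.L a msq) := by ring

/-- `L^k · distX_k = T` (the η-units bookkeeping of the leaf's `K0` clause). [folklore] -/
theorem pow_mul_distX_eq (x x' : Site P 0) :
    (P.L : ℝ) ^ S.k * distX P S.k x x' = T P 0 x x' := by
  unfold B5Ineq137Torus.distX
  rw [mul_inv_cancel_left₀ (pow_ne_zero _ P.cast_L_pos.ne')]

/-! ## §2. `LeafK0` for the VALUE leg: `K0v = C^{(0)}` -/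

/-- **`LeafK0 (dataV)`**: `|K0v(x,x′)| = |C^{(0)}(x,x′)| ≤ cK0·e^{−dK0·L^k|x−x′|_η}` — pv07-g7's `G0unit_decay` read through
`SliceLegs.K0v_eq`. [cite: Balaban1983RegularityDecay, (2.34)/(2.37) p.582] -/
theorem leafK0_dataV {a msq : ℝ} (ha : 0 < a) (hm : 0 ≤ msq) :
    LeafK0 S (dataV P S a msq) P.L (cK0 P.d P.L a msq) (dK0 P.d P.L a msq) := by
  intro μ ν x x'
  show |K0v P a msq μ ν x x'| ≤
    cK0 P.d P.L a msq * Real.exp (-(dK0 P.d P.L a msq * ((P.L : ℝ) ^ S.k * distX P S.k x x')))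
  rw [pow_mul_distX_eq, K0v_eq ha hm]
  exact decay_mono (T_nonneg P 0 x x') (two_div_gamma0_le_cK0 (P := P) ha hm)
    (div_pos two_pos (gamma0_pos (P := P) ha)).le le_rfl (G0unit_decay ha hm x x')

/-! ## §3. `LeafK0` for the GRADIENT leg: `K0g = ∂¹_μ C^{(0)}` -/

/-- The kernel of `∂¹_μ M` is the forward difference of the kernel of `M` in the first variable. [folklore] -/
theorem deriv_one_mul_apply (μ : Fin P.d) (M : Matrix (Site P 0) (Site P 0) ℝ) (x x' : Site P 0) :
    (deriv P 0 1 μ * M) x x' = M (Site.shift x μ) x' - M x x' := by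
  have h : (deriv P 0 1 μ * M) x x' = (deriv P 0 1 μ *ᵥ fun z => M z x') x := by
    simp only [Matrix.mul_apply, Matrix.mulVec, dotProduct]
  rw [h, deriv_mulVec, inv_one, one_mul]

/-- A shifted exponential: `e^{−δ|x+e_μ−x′|} ≤ e^{δ}·e^{−δ|x−x′|}` (`δ ≥ 0`, one-step triangle inequality). [folklore] -/
theorem exp_shift_le {δ : ℝ} (hδ : 0 ≤ δ) (x x' : Site P 0) (μ : Fin P.d) :
    Real.exp (-(δ * T P 0 (Site.shift x μ) x')) ≤ Real.exp δ * Real.exp (-(δ * T P 0 x x')) := by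
  have h0 := T_triangle P 0 x (Site.shift x μ) x'
  have h1 := T_shift_le_one P x μ
  rw [← Real.exp_add]
  exact Real.exp_le_exp.mpr (by nlinarith)

/-- **`LeafK0 (dataG)`**: `|K0g_μ(x,x′)| = |C^{(0)}(x+e_μ,x′) − C^{(0)}(x,x′)| ≤ (2/γ₀)(e^{δ₁}+1)e^{−δ₁|x−x′|} ≤ cK0·e^{−dK0·L^k|x−x′|_η}`.
[cite: Balaban1983RegularityDecay, (2.37) p.582] -/
theorem leafK0_dataG {a msq : ℝ} (ha : 0 < a) (hm : 0 ≤ msq) :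
    LeafK0 S (dataG P S a msq) P.L (cK0 P.d P.L a msq) (dK0 P.d P.L a msq) := by
  intro μ ν x x'
  show |K0g P a msq μ ν x x'| ≤
    cK0 P.d P.L a msq * Real.exp (-(dK0 P.d P.L a msq * ((P.L : ℝ) ^ S.k * distX P S.k x x')))
  rw [pow_mul_distX_eq, K0g_eq ha hm, deriv_one_mul_apply]
  set δ := dK0 P.d P.L a msq with hδdef
  set C := 2 / gamma0 P.L a with hCdef
  have hC : 0 ≤ C := (div_pos two_pos (gamma0_pos (P := P) ha)).le
  have hδ : 0 ≤ δ := (dK0_pos (P := P) ha hm).le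
  have h1 := G0unit_decay ha hm (Site.shift x μ) x'
  have h2 := G0unit_decay ha hm x x'
  have hE : 0 ≤ Real.exp (-(δ * T P 0 x x')) := (Real.exp_pos _).le
  calc |G0unit P a msq (Site.shift x μ) x' - G0unit P a msq x x'|
      ≤ |G0unit P a msq (Site.shift x μ) x'| + |G0unit P a msq x x'| := abs_sub _ _
    _ ≤ C * Real.exp (-(δ * T P 0 (Site.shift x μ) x')) + C * Real.exp (-(δ * T P 0 x x')) := add_le_add h1 h2
    _ ≤ C * (Real.exp δ * Real.exp (-(δ * T P 0 x x'))) + C * Real.exp (-(δ * T P 0 x x')) := by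
        have := mul_le_mul_of_nonneg_left (exp_shift_le hδ x x' μ) hC
        linarith
    _ = C * (Real.exp δ + 1) * Real.exp (-(δ * T P 0 x x')) := by ring
    _ ≤ cK0 P.d P.L a msq * Real.exp (-(δ * T P 0 x x')) :=
        mul_le_mul_of_nonneg_right (shifted_const_le_cK0 (P := P) ha hm) hE

/-! ## §4. The leaf of each leg from pv07's `LeafK123` alone -/

/-- Monotonicity of `LeafK0` in the constants, for any scale data with a nonnegative `L^k·distX`. [folklore] -/
theorem leafK0_mono {D : B5Ineq137.ScaleData S} {Lr c c' δ δ' : ℝ} (ht : ∀ x x', 0 ≤ Lr ^ S.k * D.distX x x')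
    (hc0 : 0 ≤ c) (hc : c ≤ c') (hδ : δ' ≤ δ) (h : LeafK0 S D Lr c δ) : LeafK0 S D Lr c' δ' :=
  fun μ ν x x' => decay_mono (ht x x') hc hc0 hδ (h μ ν x x')

/-- `L^k·distX ≥ 0` for the three concrete scale data (they share the distance of `dataM`). [folklore] -/
theorem pow_mul_distX_nonneg (x x' : Site P 0) : 0 ≤ (P.L : ℝ) ^ S.k * distX P S.k x x' := by
  rw [pow_mul_distX_eq]; exact T_nonneg P 0 x x'

/-- **MIXED leg**: `Leaf235to237 (dataM)` from `LeafK123 (dataM)` — pv07-g7's `leaf235to237_of_K123` read on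
`dataM ≡ scaleData P S (aux P S ⊥ 0)`. [cite: Balaban1984PropagatorsI, (1.137) p.40] -/
theorem leaf_dataM_of_K123 {a msq c₀ δ₀' : ℝ} (ha : 0 < a) (hm : 0 ≤ msq) (hc : cK0 P.d P.L a msq ≤ c₀)
    (hδ : δ₀' ≤ dK0 P.d P.L a msq) (h123 : LeafK123 S (dataM P S a msq) c₀ δ₀') :
    B5Ineq137.Leaf235to237 (dataM P S a msq) P.L c₀ δ₀' :=
  leaf235to237_of_K123 (fun _ _ => False) (fun _ _ _ => 0) ha hm hc hδ h123

/-- **VALUE leg**: `Leaf235to237 (dataV)` from `LeafK123 (dataV)`, any `c₀ ≥ cK0`, `δ₀′ ≤ dK0`.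
[cite: Balaban1984PropagatorsI, (1.137) p.40] -/
theorem leaf_dataV_of_K123 {a msq c₀ δ₀' : ℝ} (ha : 0 < a) (hm : 0 ≤ msq) (hc : cK0 P.d P.L a msq ≤ c₀)
    (hδ : δ₀' ≤ dK0 P.d P.L a msq) (h123 : LeafK123 S (dataV P S a msq) c₀ δ₀') :
    B5Ineq137.Leaf235to237 (dataV P S a msq) P.L c₀ δ₀' :=
  (leaf235to237_iff (dataV P S a msq) P.L c₀ δ₀').mpr
    ⟨leafK0_mono (D := dataV P S a msq) (pow_mul_distX_nonneg (P := P) (S := S)) (cK0_nonneg (P := P) ha) hc hδ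
      (leafK0_dataV ha hm), h123⟩

/-- **GRADIENT leg**: `Leaf235to237 (dataG)` from `LeafK123 (dataG)`, any `c₀ ≥ cK0`, `δ₀′ ≤ dK0`.
[cite: Balaban1984PropagatorsI, (1.137) p.40] -/
theorem leaf_dataG_of_K123 {a msq c₀ δ₀' : ℝ} (ha : 0 < a) (hm : 0 ≤ msq) (hc : cK0 P.d P.L a msq ≤ c₀)
    (hδ : δ₀' ≤ dK0 P.d P.L a msq) (h123 : LeafK123 S (dataG P S a msq) c₀ δ₀') :
    B5Ineq137.Leaf235to237 (dataG P S a msq) P.L c₀ δ₀' :=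
  (leaf235to237_iff (dataG P S a msq) P.L c₀ δ₀').mpr
    ⟨leafK0_mono (D := dataG P S a msq) (pow_mul_distX_nonneg (P := P) (S := S)) (cK0_nonneg (P := P) ha) hc hδ
      (leafK0_dataG ha hm), h123⟩

/-! ## §5. The three tail theorems of `SliceLegs` §4 with the leaf hypothesis reduced to `LeafK123` -/

/-- `cK0 ≤ c₀` makes `c₀ ≥ 0`. [folklore] -/
theorem c₀_nonneg_of_cK0_le {a msq c₀ : ℝ} (ha : 0 < a) (hc : cK0 P.d P.L a msq ≤ c₀) : 0 ≤ c₀ :=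
  (cK0_nonneg (P := P) ha).trans hc

/-- **MIXED LEG, hFtail shape, leaf = K123 only** (`a = d`). [cite: Balaban1984PropagatorsI, (1.137) p.40] -/
theorem mixedLeg_tail_of_K123 {a msq : ℝ} (ha : 0 < a) (hm : 0 ≤ msq) (hk : 1 ≤ S.k) (hkK : S.k ≤ P.m + P.K + 1)
    {c₀ δ₀' ā : ℝ} (hc : cK0 P.d P.L a msq ≤ c₀) (hδ : 0 < δ₀') (hδ' : δ₀' ≤ dK0 P.d P.L a msq)
    (hā : ∀ j, |B1.aSeq a P.L j| ≤ ā) (h123 : LeafK123 S (dataM P S a msq) c₀ δ₀') (μ ν : Fin P.d)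
    {x x' : Site P 0} (hx : x ≠ x') :
    |(deriv P 0 P.eps μ * (tower P a msq).G S.k * (deriv P 0 P.eps ν)ᵀ) x x'|
      ≤ legConst P c₀ δ₀' ā P.d / T P 0 x x' ^ P.d * Real.exp (-(3 / 8 * δ₀' / (P.L : ℝ) ^ S.k) * T P 0 x x')
    ∧ |(deriv P 0 P.eps μ * (tower P a msq).G S.k * (deriv P 0 P.eps ν)ᵀ) x x'|
      ≤ legConst P c₀ δ₀' ā P.d / T P 0 x x' ^ P.d :=
  Beta.SliceLegs.mixedLeg_tail ha hm hk hkK (c₀_nonneg_of_cK0_le (P := P) ha hc) hδ hā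
    (leaf_dataM_of_K123 ha hm hc hδ' h123) μ ν hx

/-- **VALUE LEG, hFtail / hGtail shapes, leaf = K123 only** (`a = s = d − 2`). [cite: Balaban1984PropagatorsI, (1.137) p.40] -/
theorem valueLeg_tail_of_K123 {a msq : ℝ} (ha : 0 < a) (hm : 0 ≤ msq) {s : ℕ} (hs : 1 ≤ s) (hds : P.d = s + 2)
    (hk : 1 ≤ S.k) (hkK : S.k ≤ P.m + P.K + 1) {c₀ δ₀' ā : ℝ} (hc : cK0 P.d P.L a msq ≤ c₀) (hδ : 0 < δ₀')
    (hδ' : δ₀' ≤ dK0 P.d P.L a msq) (hā : ∀ j, |B1.aSeq a P.L j| ≤ ā)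
    (h123 : LeafK123 S (dataV P S a msq) c₀ δ₀') {x x' : Site P 0} (hx : x ≠ x') :
    |(P.eps ^ 2)⁻¹ * (tower P a msq).G S.k x x'|
      ≤ legConst P c₀ δ₀' ā s / T P 0 x x' ^ s * Real.exp (-(3 / 8 * δ₀' / (P.L : ℝ) ^ S.k) * T P 0 x x')
    ∧ |(P.eps ^ 2)⁻¹ * (tower P a msq).G S.k x x'| ≤ legConst P c₀ δ₀' ā s / T P 0 x x' ^ s :=
  Beta.SliceLegs.valueLeg_tail ha hm hs hds hk hkK (c₀_nonneg_of_cK0_le (P := P) ha hc) hδ hā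
    (leaf_dataV_of_K123 ha hm hc hδ' h123) hx

/-- **GRADIENT LEG, hFtail / hGtail shapes, leaf = K123 only** (`a = s = d − 1`). [cite: Balaban1984PropagatorsI, (1.137) p.40] -/
theorem gradLeg_tail_of_K123 {a msq : ℝ} (ha : 0 < a) (hm : 0 ≤ msq) {s : ℕ} (hs : 1 ≤ s) (hds : P.d = s + 1)
    (hk : 1 ≤ S.k) (hkK : S.k ≤ P.m + P.K + 1) {c₀ δ₀' ā : ℝ} (hc : cK0 P.d P.L a msq ≤ c₀) (hδ : 0 < δ₀')
    (hδ' : δ₀' ≤ dK0 P.d P.L a msq) (hā : ∀ j, |B1.aSeq a P.L j| ≤ ā)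
    (h123 : LeafK123 S (dataG P S a msq) c₀ δ₀') (μ : Fin P.d) {x x' : Site P 0} (hx : x ≠ x') :
    |P.eps⁻¹ * (deriv P 0 P.eps μ * (tower P a msq).G S.k) x x'|
      ≤ legConst P c₀ δ₀' ā s / T P 0 x x' ^ s * Real.exp (-(3 / 8 * δ₀' / (P.L : ℝ) ^ S.k) * T P 0 x x')
    ∧ |P.eps⁻¹ * (deriv P 0 P.eps μ * (tower P a msq).G S.k) x x'| ≤ legConst P c₀ δ₀' ā s / T P 0 x x' ^ s :=
  Beta.SliceLegs.gradLeg_tail ha hm hs hds hk hkK (c₀_nonneg_of_cK0_le (P := P) ha hc) hδ hā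
    (leaf_dataG_of_K123 ha hm hc hδ' h123) μ hx

/-- Non-vacuity of the constants' hypotheses: with `c₀ := cK0`, `δ₀′ := dK0` both side conditions hold. [folklore] -/
example {a msq : ℝ} (ha : 0 < a) (hm : 0 ≤ msq) :
    cK0 P.d P.L a msq ≤ cK0 P.d P.L a msq ∧ 0 < dK0 P.d P.L a msq ∧ dK0 P.d P.L a msq ≤ dK0 P.d P.L a msq :=
  ⟨le_rfl, dK0_pos (P := P) ha hm, le_rfl⟩

end Beta.SliceLegsLeafK0

end

end Literature.MathematicalPhysics.QuantumFieldTheory.Balaban1983to89
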